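import Summits.ValiantsHypothesis.ValiantsHypothesis.Theses.ProjectionStability
import Summits.ValiantsHypothesis.ValiantsHypothesis.Theorems.PdcQpOfVp.Negative.AffineToProjectionBlowup
import Literature.Computability.AlgebraicComplexity.LandsbergRessayreNormalForm

/-!
# `UniqStep` (crux stmt-ValiantsHypothesis-17834, route `ProjectionStability`): the guard `n ≥ 3` is
# load-bearing — uniqueness of optimal projections already FAILS at level 2 (negative-side support)

The crux is `∀ n ≥ 3, Opt n → Uniq n → Opt (n+1) → Uniq (n+1)` (`Opt k := 2ᵏ − 1 ≤ pdc(per_k)`,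
`Uniq k :=` honest `pdc × pdc` projections of `per_k` are unique modulo constant gauge `GL × GL`, a
substitution `γ ∈ permSymmetrySubst ℂ k` and possibly matrix transpose).  Sorry-free record that the same
step taken from `n = 1` is FALSE (`uniqStep_false_from_one`), i.e. any proof of `UniqStep` must use `n ≥ 2`:

* `pdc(per_1) = 1`, `pdc(per_2) = 3 = 2² − 1` (Grenet is optimal at level 2; second differences of
  `per_2 (t,t,t,t) = 2t²` exclude sizes `≤ 2`), and `Uniq 1` holds — so the three hypotheses of the step at
  `n = 1` are honestly discharged;
* **`Uniq 2` is false** (`uniq_two_false`, explicit size: `uniqAt_two_three_false`): the honest projections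
  `R = [[x₀₀, x₀₁, 0], [0, x₁₁, x₁₀], [1, 0, 1]]` (the optimal AFFINE representation
  `[[x₀₀, x₀₁], [−x₁₀, x₁₁]]` of size `dc(per_2) = 2`, bordered to pay for its sign) and Grenet's
  `G = [[0, x₀₀, x₀₁], [x₁₁, −1, 0], [x₁₀, 0, −1]]` both have determinant `per_2`; the substitution `γ` fixes
  constant parts (`constPart_linSubstEntries`), so a relation `G = P·R(γx)·Q` or `G = P·R(γx)ᵀ·Q` gives
  `Λ_G = P Λ_R Q` or `P Λ_Rᵀ Q` for the constant parts; `Λ_R` has rank one, hence so has the right side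
  (its `2 × 2` minor on rows/columns `{1,2}` vanishes identically in the entries of `P, Q`), while that
  minor of `Λ_G = diag(0, −1, −1)` is `1`.

Exhaustive computation behind the choice of witnesses (refuter folder `compute/per2_*.py`, exact
arithmetic; not used in the proofs): the honest `3 × 3` projections of `per_2` over `ℂ` are exactly 1008
matrices in exactly two gauge orbits (864 ~ `R`, 144 ~ `G`).  The mechanism (a corank-2 constant part,
i.e. `dc < pdc`) is unavailable at levels 3 and 4, where every affine representation of `per_n` of any size
`m` has constant part of rank `m − 1`; this file therefore refutes nothing at the crux's levels — it pins the
guard.  The gauge invariants for orbit tests at every `(n, m)` (constant-part rank; coefficient-rank profile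
via monomiality of `permSymmetrySubst ℂ n`) are in the sibling file `Negative/GaugeInvariants.lean`.
Refuter cdisprove cycle 1, 2026-08-17; `pdc(per_1) = 1`, `pdc(per_2) = 3` are imported from the tree
(`Theorems/PdcQpOfVp/Negative/AffineToProjectionBlowup.lean`).
-/

noncomputable section

set_option linter.dupNamespace false

namespace Summit.ValiantsHypothesis.ValiantsHypothesis.Theorems.UniqStep.Negative

open MvPolynomial Literature.Computability.AlgebraicComplexity
open scoped Matrix

/-! The small-model values `pdc(per_1) = 1`, `pdc(per_2) = 3` and `per_2 = x₀₀x₁₁ + x₀₁x₁₀` are already in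
the tree (`Theorems/PdcQpOfVp/Negative/AffineToProjectionBlowup.lean`,
`Theorems/PermHypersurfaceFactorial/Negative/DerivationSymbolicSquareLoadBearing.lean`) and are used from there. -/

open Summit.ValiantsHypothesis.Theorems.PdcQpOfVp.Negative
  (detProjectionComplexity_perPoly_two detProjectionComplexity_perPoly_one)
open Summit.ValiantsHypothesis.ValiantsHypothesis.Theorems.PermHypersurfaceFactorial.Negative (perPoly_fin_two)

/-- **Two gauge orbits of honest `3 × 3` projections of `per_2`.**  `R = [[x₀₀, x₀₁, 0], [0, x₁₁, x₁₀],
[1, 0, 1]]` (bordered optimal affine representation, constant part of rank `1`) and Grenet₂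
`G = [[0, x₀₀, x₀₁], [x₁₁, -1, 0], [x₁₀, 0, -1]]` (constant part of rank `2`) both have determinant `per_2`
and are NOT related by any `(P, Q, γ)`, `P, Q ∈ GL₃(ℂ)`, `γ ∈ permSymmetrySubst ℂ 2`, with or without
transpose. [folklore] -/
theorem uniqAt_two_three_false :
    ¬ ∀ A B : Matrix (Fin 3) (Fin 3) (MvPolynomial (Fin 2 × Fin 2) ℂ),
      (∀ i j, (∃ v, A i j = MvPolynomial.X v) ∨ ∃ c, A i j = MvPolynomial.C c) →
      (∀ i j, (∃ v, B i j = MvPolynomial.X v) ∨ ∃ c, B i j = MvPolynomial.C c) →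
      A.det = perPoly (Fin 2) ℂ → B.det = perPoly (Fin 2) ℂ →
      ∃ (P Q : GL (Fin 3) ℂ) (γ : GL (Fin 2 × Fin 2) ℂ), γ ∈ permSymmetrySubst ℂ 2 ∧
        (B = (P : Matrix (Fin 3) (Fin 3) ℂ).map MvPolynomial.C * Matrix.linSubstEntries γ A *
            (Q : Matrix (Fin 3) (Fin 3) ℂ).map MvPolynomial.C ∨
          B = (P : Matrix (Fin 3) (Fin 3) ℂ).map MvPolynomial.C * (Matrix.linSubstEntries γ A)ᵀ *
            (Q : Matrix (Fin 3) (Fin 3) ℂ).map MvPolynomial.C) := by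
  intro h
  obtain ⟨R, hRdef⟩ : ∃ M : Matrix (Fin 3) (Fin 3) (MvPolynomial (Fin 2 × Fin 2) ℂ), M =
      !![X (0, 0), X (0, 1), C 0; C 0, X (1, 1), X (1, 0); C 1, C 0, C 1] := ⟨_, rfl⟩
  obtain ⟨G, hGdef⟩ : ∃ M : Matrix (Fin 3) (Fin 3) (MvPolynomial (Fin 2 × Fin 2) ℂ), M =
      !![C 0, X (0, 0), X (0, 1); X (1, 1), C (-1), C 0; X (1, 0), C 0, C (-1)] := ⟨_, rfl⟩
  have hR : ∀ i j, (∃ v, R i j = X v) ∨ ∃ c, R i j = C c := by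
    intro i j; subst hRdef
    fin_cases i <;> fin_cases j <;>
      first | exact Or.inl ⟨_, rfl⟩ | exact Or.inr ⟨_, rfl⟩
  have hG : ∀ i j, (∃ v, G i j = X v) ∨ ∃ c, G i j = C c := by
    intro i j; subst hGdef
    fin_cases i <;> fin_cases j <;>
      first | exact Or.inl ⟨_, rfl⟩ | exact Or.inr ⟨_, rfl⟩
  have hdR : R.det = perPoly (Fin 2) ℂ := by
    subst hRdef; rw [perPoly_fin_two, Matrix.det_fin_three]; simp
  have hdG : G.det = perPoly (Fin 2) ℂ := by
    subst hGdef; rw [perPoly_fin_two, Matrix.det_fin_three]; simp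
  have cR : constPart R = !![0, 0, 0; 0, 0, 0; 1, 0, 1] := by
    subst hRdef; ext i j; fin_cases i <;> fin_cases j <;> simp [constPart]
  have cG : constPart G = !![0, 0, 0; 0, -1, 0; 0, 0, -1] := by
    subst hGdef; ext i j; fin_cases i <;> fin_cases j <;> simp [constPart]
  have constPart_transpose : ∀ M : Matrix (Fin 3) (Fin 3) (MvPolynomial (Fin 2 × Fin 2) ℂ),
      constPart Mᵀ = (constPart M)ᵀ := fun M => Matrix.transpose_map
  obtain ⟨P, Q, γ, -, hPQ⟩ := h R G hR hG hdR hdG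
  rcases hPQ with e | e
  · have key := congrArg constPart e
    rw [constPart_mul, constPart_mul, constPart_map_C, constPart_map_C, constPart_linSubstEntries,
      cR, cG] at key
    have e11 := congrFun (congrFun key 1) 1
    have e12 := congrFun (congrFun key 1) 2
    have e21 := congrFun (congrFun key 2) 1
    have e22 := congrFun (congrFun key 2) 2
    simp [Matrix.mul_apply, Fin.sum_univ_three, -mul_eq_zero, -zero_eq_mul] at e11 e12 e21 e22
    have hh : (1 : ℂ) = 0 := by
      linear_combination ((P : Matrix (Fin 3) (Fin 3) ℂ) 2 2 * ((Q : Matrix (Fin 3) (Fin 3) ℂ) 0 2 +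
          (Q : Matrix (Fin 3) (Fin 3) ℂ) 2 2)) * e11 - e22 -
        ((P : Matrix (Fin 3) (Fin 3) ℂ) 2 2 * ((Q : Matrix (Fin 3) (Fin 3) ℂ) 0 1 +
          (Q : Matrix (Fin 3) (Fin 3) ℂ) 2 1)) * e12
    norm_num at hh
  · have key := congrArg constPart e
    rw [constPart_mul, constPart_mul, constPart_map_C, constPart_map_C, constPart_transpose,
      constPart_linSubstEntries, cR, cG] at key
    have e11 := congrFun (congrFun key 1) 1
    have e12 := congrFun (congrFun key 1) 2
    have e21 := congrFun (congrFun key 2) 1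
    have e22 := congrFun (congrFun key 2) 2
    simp [Matrix.mul_apply, Fin.sum_univ_three, -mul_eq_zero, -zero_eq_mul] at e11 e12 e21 e22
    have hh : (1 : ℂ) = 0 := by
      linear_combination (((P : Matrix (Fin 3) (Fin 3) ℂ) 2 0 + (P : Matrix (Fin 3) (Fin 3) ℂ) 2 2) *
          (Q : Matrix (Fin 3) (Fin 3) ℂ) 2 2) * e11 - e22 -
        (((P : Matrix (Fin 3) (Fin 3) ℂ) 2 0 + (P : Matrix (Fin 3) (Fin 3) ℂ) 2 2) *
          (Q : Matrix (Fin 3) (Fin 3) ℂ) 2 1) * e12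
    norm_num at hh

/-- **`Uniq 2` is false** — verbatim the uniqueness clause of the crux at level `2` (size
`pdc(per_2)`, which is `3`): optimal honest projections of `per_2` are not unique modulo constant gauge ×
`permSymmetrySubst` × transpose. [folklore] -/
theorem uniq_two_false :
    ¬ ∀ A B : Matrix (Fin (detProjectionComplexity (perPoly (Fin 2) ℂ)))
        (Fin (detProjectionComplexity (perPoly (Fin 2) ℂ))) (MvPolynomial (Fin 2 × Fin 2) ℂ),
      (∀ i j, (∃ v, A i j = MvPolynomial.X v) ∨ ∃ c, A i j = MvPolynomial.C c) →
      (∀ i j, (∃ v, B i j = MvPolynomial.X v) ∨ ∃ c, B i j = MvPolynomial.C c) →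
      A.det = perPoly (Fin 2) ℂ → B.det = perPoly (Fin 2) ℂ →
      ∃ (P Q : GL (Fin (detProjectionComplexity (perPoly (Fin 2) ℂ))) ℂ) (γ : GL (Fin 2 × Fin 2) ℂ),
        γ ∈ permSymmetrySubst ℂ 2 ∧
        (B = (P : Matrix _ _ ℂ).map MvPolynomial.C * Matrix.linSubstEntries γ A *
            (Q : Matrix _ _ ℂ).map MvPolynomial.C ∨
          B = (P : Matrix _ _ ℂ).map MvPolynomial.C * (Matrix.linSubstEntries γ A)ᵀ *
            (Q : Matrix _ _ ℂ).map MvPolynomial.C) := by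
  rw [detProjectionComplexity_perPoly_two]
  exact uniqAt_two_three_false

/-- **The guard `n ≥ 3` of `UniqStep` is load-bearing**: the crux's statement with `n ≥ 3` replaced by
`n ≥ 1` (verbatim otherwise) is FALSE — at `n = 1` the hypotheses `2¹ − 1 ≤ pdc(per_1)`, uniqueness at
level 1 (the only optimal projection of `per_1 = x₀₀` is `(x₀₀)`), `2² − 1 ≤ pdc(per_2)` hold, and the
conclusion (uniqueness at level 2) fails by `uniq_two_false`. [folklore] -/
theorem uniqStep_false_from_one :
    ¬ ∀ n ≥ 1, 2 ^ n - 1 ≤ detProjectionComplexity (perPoly (Fin n) ℂ) →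
      (∀ A B : Matrix (Fin (detProjectionComplexity (perPoly (Fin n) ℂ)))
          (Fin (detProjectionComplexity (perPoly (Fin n) ℂ))) (MvPolynomial (Fin n × Fin n) ℂ),
        (∀ i j, (∃ v, A i j = MvPolynomial.X v) ∨ ∃ c, A i j = MvPolynomial.C c) →
        (∀ i j, (∃ v, B i j = MvPolynomial.X v) ∨ ∃ c, B i j = MvPolynomial.C c) →
        A.det = perPoly (Fin n) ℂ → B.det = perPoly (Fin n) ℂ →
        ∃ (P Q : GL (Fin (detProjectionComplexity (perPoly (Fin n) ℂ))) ℂ) (γ : GL (Fin n × Fin n) ℂ),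
          γ ∈ permSymmetrySubst ℂ n ∧
          (B = (P : Matrix _ _ ℂ).map MvPolynomial.C * Matrix.linSubstEntries γ A *
              (Q : Matrix _ _ ℂ).map MvPolynomial.C ∨
            B = (P : Matrix _ _ ℂ).map MvPolynomial.C * (Matrix.linSubstEntries γ A)ᵀ *
              (Q : Matrix _ _ ℂ).map MvPolynomial.C)) →
      2 ^ (n + 1) - 1 ≤ detProjectionComplexity (perPoly (Fin (n + 1)) ℂ) →
      ∀ A B : Matrix (Fin (detProjectionComplexity (perPoly (Fin (n + 1)) ℂ)))
          (Fin (detProjectionComplexity (perPoly (Fin (n + 1)) ℂ))) (MvPolynomial (Fin (n + 1) × Fin (n + 1)) ℂ),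
        (∀ i j, (∃ v, A i j = MvPolynomial.X v) ∨ ∃ c, A i j = MvPolynomial.C c) →
        (∀ i j, (∃ v, B i j = MvPolynomial.X v) ∨ ∃ c, B i j = MvPolynomial.C c) →
        A.det = perPoly (Fin (n + 1)) ℂ → B.det = perPoly (Fin (n + 1)) ℂ →
        ∃ (P Q : GL (Fin (detProjectionComplexity (perPoly (Fin (n + 1)) ℂ))) ℂ)
          (γ : GL (Fin (n + 1) × Fin (n + 1)) ℂ), γ ∈ permSymmetrySubst ℂ (n + 1) ∧
          (B = (P : Matrix _ _ ℂ).map MvPolynomial.C * Matrix.linSubstEntries γ A *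
              (Q : Matrix _ _ ℂ).map MvPolynomial.C ∨
            B = (P : Matrix _ _ ℂ).map MvPolynomial.C * (Matrix.linSubstEntries γ A)ᵀ *
              (Q : Matrix _ _ ℂ).map MvPolynomial.C) := by
  intro h
  refine uniq_two_false (h 1 le_rfl ?_ ?_ ?_)
  · rw [detProjectionComplexity_perPoly_one]; norm_num
  · -- uniqueness at level 1: `pdc(per_1) = 1`, and a `1 × 1` matrix is its determinant
    intro A B hA hB hdA hdB
    have h1 := detProjectionComplexity_perPoly_one
    haveI : Subsingleton (Fin (detProjectionComplexity (perPoly (Fin 1) ℂ))) := by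
      rw [h1]; infer_instance
    obtain ⟨k⟩ : Nonempty (Fin (detProjectionComplexity (perPoly (Fin 1) ℂ))) := by
      rw [h1]; infer_instance
    rw [Matrix.det_eq_elem_of_subsingleton _ k] at hdA hdB
    have hAB : B = A := by
      ext i j
      rw [Subsingleton.elim i k, Subsingleton.elim j k, hdA, hdB]
    refine ⟨1, 1, 1, Subgroup.one_mem _, Or.inl ?_⟩
    simp [hAB, Matrix.map_one C C_0 C_1]
  · rw [detProjectionComplexity_perPoly_two]; norm_num


end Summit.ValiantsHypothesis.ValiantsHypothesis.Theorems.UniqStep.Negative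

end
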